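import Summits.CriticalPhenomena.PercolationContinuityZ3.Theorems.FK.EdgeDensityContinuityCriterion
import Summits.CriticalPhenomena.PercolationContinuityZ3.Theorems.FK.UniquenessOfEqualTheta
import Summits.CriticalPhenomena.PercolationContinuityZ3.Theorems.FK.UniquenessCriticalFKIsing
import HarnessLib

/-!
# FK-continuity cell, FO-10a: `θ⁰(p,q) = θ¹(p,q)` iff the edge density is continuous at `p`; at `p_c(q)`:
# wired continuity `T_W(q)` ⟺ free non-percolation `T_F(q)` ∧ NO LATENT HEAT (continuity of `h⁰(·,q)` at `p_c(q)`)
# (Grimmett 2006, Thm. (4.63) (b) with Thm. (5.16)(c))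

Registered R77 (cell INBOX l.5711, 2026-08-23); registry row FO-10a-g336h; label LHT-B (coordinator fk-4 g167).
Cell `fk-continuity` (bschramm), row FO-10a (domain-Markov + comparison layer over FO-06); support file for the
FK-continuity transplant (`--supports stmt-CriticalPhenomena-4575`); builds on p205010 (kernel theorem, internal audit
signed; external expert review pending). Pure proofs; no definitions, no named facts, no sorries; general dimension `d`.

`EdgeDensityContinuityCriterion.lean` (Thm. (4.63) (b) ⟺ (d): `φ⁰_{p,q} = φ¹_{p,q}` iff `h⁰(·,q)` is continuous at `p`)
composed with `UniquenessOfEqualTheta.lean` (Thm. (5.16)(c): `φ⁰_{p,q} = φ¹_{p,q}` iff `θ⁰(p,q) = θ¹(p,q)`) and row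
FO-10a-g335's seams at `p_c(q)` (`UniquenessOfNonPercolationTheta.lean`: `T_W ⟺ T_F ∧ φ⁰_{p_c} = φ¹_{p_c}`,
`T_U ⟺ (T_F ⇒ φ⁰_{p_c} = φ¹_{p_c})`):

* `thetaFree_eq_thetaWired_iff_continuousAt_freeEdgeDensity`, `fkUniqueAt_iff_continuousAt_freeEdgeDensity` —
  **`θ⁰(p,q) = θ¹(p,q)` iff the edge density is continuous at `p`** (`0 < p < 1`, `q ≥ 1`);
* `fkContinuityWired_iff_free_and_continuousAt_freeEdgeDensity` — **`T_W(q) ⟺ T_F(q) ∧ (h⁰(·,q) continuous at p_c(q))`**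
  (`d ≥ 2`, `q ≥ 1`): continuity of the FK(`q`) percolation transition is free non-percolation at `p_c(q)` PLUS continuity
  of the energy density at `p_c(q)` (no latent heat); `fkTransferAtCritical_iff_continuousAt_freeEdgeDensity` — the cell's
  transfer residual `T_U(q)` (Raoufi 2020 Q4 for `q ∈ (1,2)`) IS "free non-percolation forces no latent heat at `p_c(q)`";
* `continuousAt_freeEdgeDensity_rcCriticalProb_two`, `continuousAt_wiredEdgeDensity_rcCriticalProb_two` — `q = 2`, `d ≥ 3`:
  the energy density of the critical FK–Ising model on `ℤ^d` is continuous at `p_c(2)` (corollary import of the in-tree ADS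
  chain through NPC-D `rcLimit_false_eq_rcLimit_true_rcCriticalProb_two`; no priority claimed).

Honest framing: unconditional structure + the `q = 2` corollary import; it DECIDES nothing about `q ∈ (1,2)`; NOT a binder
discharge, NOT `_r4`; n_open = 2 unchanged.

## References
* G. Grimmett, *The Random-Cluster Model*, Springer 2006 (`book:grimmett2006-random-cluster-model`): Thm. (4.63),
  Thm. (5.16)(c), Thm. (5.33)(a), Conj. (5.34) [PDF pp. 88–89, 101–107]. [Grimmett2006]
* M. Aizenman, H. Duminil-Copin, V. Sidoravicius, Comm. Math. Phys. 334 (2015), Thm. 1.2, Cor. 1.5(1).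
  [AizenmanDuminilCopinSidoraviciusCMP2015]
-/

noncomputable section

open MeasureTheory Set Filter
open scoped Topology ENNReal

namespace Summit.CriticalPhenomena.PercolationContinuityZ3.Theorems.FK

open Literature.Probability.Percolation Literature.Probability.LatticeModels Literature.Barriers.CriticalPhenomena

variable {d : ℕ} {p q : ℝ} {e : Sym2 (Site d)}

/-! ### `θ⁰ = θ¹` iff the edge density is continuous -/

/-- **`θ⁰(p,q) = θ¹(p,q)` iff `x ↦ h⁰(x,q)(e)` is continuous at `x = p`** (`0 < p < 1`, `q ≥ 1`, `e` a lattice edge):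
Thm. (5.16)(c) with Thm. (4.63) (b). [cite: Grimmett2006, Thm. (5.16)(c) with Thm. (4.63)] -/
theorem thetaFree_eq_thetaWired_iff_continuousAt_freeEdgeDensity (hp : p ∈ Set.Ioo (0 : ℝ) 1) (hq : 1 ≤ q)
    (he : e ∈ (zdGraph d).edgeSet) :
    thetaFree d p q = thetaWired d p q ↔ ContinuousAt (fun x : ℝ => freeEdgeDensity d x q e) p := by
  rw [← rcLimit_false_eq_rcLimit_true_iff_thetaFree_eq_thetaWired ⟨hp.1.le, hp.2.le⟩ hq,
    rcLimit_false_eq_rcLimit_true_iff_continuousAt_freeEdgeDensity hp hq he]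

/-- The same with the wired density `h¹(·,q)`. [cite: Grimmett2006, Thm. (5.16)(c) with Thm. (4.63)] -/
theorem thetaFree_eq_thetaWired_iff_continuousAt_wiredEdgeDensity (hp : p ∈ Set.Ioo (0 : ℝ) 1) (hq : 1 ≤ q)
    (he : e ∈ (zdGraph d).edgeSet) :
    thetaFree d p q = thetaWired d p q ↔ ContinuousAt (fun x : ℝ => wiredEdgeDensity d x q e) p := by
  rw [← rcLimit_false_eq_rcLimit_true_iff_thetaFree_eq_thetaWired ⟨hp.1.le, hp.2.le⟩ hq,
    rcLimit_false_eq_rcLimit_true_iff_continuousAt_wiredEdgeDensity hp hq he]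

/-- **The cell's seam `FK.FKUniqueAt d p q` iff the edge density is continuous at `p`** (`0 < p < 1`, `q ≥ 1`).
[cite: Grimmett2006, Thm. (5.16)(c) with Thm. (4.63)] -/
theorem fkUniqueAt_iff_continuousAt_freeEdgeDensity (hp : p ∈ Set.Ioo (0 : ℝ) 1) (hq : 1 ≤ q)
    (he : e ∈ (zdGraph d).edgeSet) :
    FKUniqueAt d p q ↔ ContinuousAt (fun x : ℝ => freeEdgeDensity d x q e) p :=
  (fkUniqueAt_iff d p q).trans (thetaFree_eq_thetaWired_iff_continuousAt_freeEdgeDensity hp hq he)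

/-- Where `θ⁰(p,q) < θ¹(p,q)` (`0 < p < 1`, `q ≥ 1`) the energy density JUMPS: neither `h⁰(·,q)` nor `h¹(·,q)` is
continuous at `p`. [cite: Grimmett2006, Thm. (5.16)(c)–(d) with Thm. (4.63)] -/
theorem not_continuousAt_edgeDensity_of_thetaFree_ne_thetaWired (hp : p ∈ Set.Ioo (0 : ℝ) 1) (hq : 1 ≤ q)
    (he : e ∈ (zdGraph d).edgeSet) (h : thetaFree d p q ≠ thetaWired d p q) :
    ¬ ContinuousAt (fun x : ℝ => freeEdgeDensity d x q e) p ∧ ¬ ContinuousAt (fun x : ℝ => wiredEdgeDensity d x q e) p :=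
  not_continuousAt_edgeDensity_of_rcLimit_false_ne_rcLimit_true hp hq he
    fun heq => h ((rcLimit_false_eq_rcLimit_true_iff_thetaFree_eq_thetaWired ⟨hp.1.le, hp.2.le⟩ hq).1 heq)

/-! ### At the critical point: `T_W(q) ⟺ T_F(q) ∧` no latent heat -/

/-- **Wired continuity ⟺ free non-percolation ∧ no latent heat**: for `d ≥ 2`, `q ≥ 1` and any lattice edge `e`,
`T_W(q)` (`θ¹(p_c(q),q) = 0`) holds **iff** `T_F(q)` (`θ⁰(p_c(q),q) = 0`) holds AND the free edge density `x ↦ h⁰(x,q)(e)`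
is continuous at `x = p_c(q)`. [cite: Grimmett2006, Thm. (5.16)(c), Conj. (5.34)(ii), Thm. (4.63)] -/
theorem fkContinuityWired_iff_free_and_continuousAt_freeEdgeDensity (hd : 2 ≤ d) (hq : 1 ≤ q)
    (he : e ∈ (zdGraph d).edgeSet) :
    FKContinuityWired d q ↔
      FKContinuityFree d q ∧ ContinuousAt (fun x : ℝ => freeEdgeDensity d x q e) (rcCriticalProb d q) := by
  rw [fkContinuityWired_iff_free_and_rcLimit_eq hq,
    rcLimit_false_eq_rcLimit_true_iff_continuousAt_freeEdgeDensity (rcCriticalProb_mem_Ioo hd hq) hq he]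

/-- **The transfer residual is "no latent heat given free non-percolation"**: for `d ≥ 2`, `q ≥ 1`, `e` a lattice edge,
`T_U(q)` (`T_F(q) ⇒ T_W(q)`; Raoufi 2020 Question 4 for `q ∈ (1,2)`) holds iff free non-percolation at `p_c(q)` forces the
continuity of `x ↦ h⁰(x,q)(e)` at `p_c(q)`. [cite: Grimmett2006, Thm. (5.16)(c) with Thm. (4.63)] [cite: Raoufi2020, Question 4] -/
theorem fkTransferAtCritical_iff_continuousAt_freeEdgeDensity (hd : 2 ≤ d) (hq : 1 ≤ q)
    (he : e ∈ (zdGraph d).edgeSet) :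
    FKTransferAtCritical d q ↔
      (FKContinuityFree d q → ContinuousAt (fun x : ℝ => freeEdgeDensity d x q e) (rcCriticalProb d q)) := by
  rw [fkTransferAtCritical_iff hq,
    rcLimit_false_eq_rcLimit_true_iff_continuousAt_freeEdgeDensity (rcCriticalProb_mem_Ioo hd hq) hq he]

/-- Under `T_W(q)` the energy density is continuous at `p_c(q)` (`d ≥ 2`, `q ≥ 1`). [cite: Grimmett2006, Conj. (5.34)(ii) with Thm. (4.63)] -/
theorem continuousAt_freeEdgeDensity_rcCriticalProb_of_fkContinuityWired (hd : 2 ≤ d) (hq : 1 ≤ q)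
    (he : e ∈ (zdGraph d).edgeSet) (h : FKContinuityWired d q) :
    ContinuousAt (fun x : ℝ => freeEdgeDensity d x q e) (rcCriticalProb d q) :=
  ((fkContinuityWired_iff_free_and_continuousAt_freeEdgeDensity hd hq he).1 h).2

/-! ### `q = 2`, `d ≥ 3`: the energy density of critical FK–Ising is continuous -/

/-- **No latent heat for critical FK–Ising on `ℤ^d`, `d ≥ 3`**: the free edge density `x ↦ h⁰(x,2)(e)` is continuous at
`p_c(2)` (corollary import of the in-tree ADS chain through NPC-D `rcLimit_false_eq_rcLimit_true_rcCriticalProb_two`).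
[cite: AizenmanDuminilCopinSidoraviciusCMP2015, Thm. 1.2 with Cor. 1.5 (1)] [cite: Grimmett2006, Thm. (4.63)] -/
theorem continuousAt_freeEdgeDensity_rcCriticalProb_two (hd : 3 ≤ d) (he : e ∈ (zdGraph d).edgeSet) :
    ContinuousAt (fun x : ℝ => freeEdgeDensity d x 2 e) (rcCriticalProb d 2) :=
  (rcLimit_false_eq_rcLimit_true_iff_continuousAt_freeEdgeDensity (rcCriticalProb_mem_Ioo (by omega) (by norm_num))
    (by norm_num) he).1 (rcLimit_false_eq_rcLimit_true_rcCriticalProb_two hd)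

/-- The same for the wired density `h¹(·,2)`. [cite: AizenmanDuminilCopinSidoraviciusCMP2015, Thm. 1.2 with Cor. 1.5 (1)] [cite: Grimmett2006, Thm. (4.63)] -/
theorem continuousAt_wiredEdgeDensity_rcCriticalProb_two (hd : 3 ≤ d) (he : e ∈ (zdGraph d).edgeSet) :
    ContinuousAt (fun x : ℝ => wiredEdgeDensity d x 2 e) (rcCriticalProb d 2) :=
  (rcLimit_false_eq_rcLimit_true_iff_continuousAt_wiredEdgeDensity (rcCriticalProb_mem_Ioo (by omega) (by norm_num))
    (by norm_num) he).1 (rcLimit_false_eq_rcLimit_true_rcCriticalProb_two hd)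

end Summit.CriticalPhenomena.PercolationContinuityZ3.Theorems.FK

end
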